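import Literature.AnabelianGeometry.SemiGraphs.ProSigmaPuncturedSurfaceElastic
import Literature.AnabelianGeometry.SemiGraphs.ProSigmaCompletionTFG
import Literature.AnabelianGeometry.AbsoluteAnabelian.AbsTopIProp23InfiniteIndexProofs
import Literature.AnabelianGeometry.AbsoluteAnabelian.FreeProlRankLinearProofs
import HarnessLib

/-!
# [AbsTopI] Prop 2.2 / Prop 2.3 (i)(ii) at the AFFINE (punctured-surface) model — proofs

S. Mochizuki, *Topics in Absolute Anabelian Geometry I: Generalities* (2012) [AbsTopI], Prop 2.2
p. 18 ("`Δ` is topologically finitely generated"), Prop 2.3 p. 19 ((i) "`Δ` is slim and elastic";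
(ii) "`Π` is slim, but not elastic", for base field an MLF or an NF).  Companion of abc-iut-L4-d1's
`AbsTopIProp23ClosedSurfaceModelProofs.lean` (the closed class `Γ_{g,0}`, `g ≥ 2`); this file is the
PUNCTURED class: extensions `1 → Δ → Π → G → 1` whose `Δ` carries a pro-`Σ` completion structure
`ι : Γ_{g,r} → Δ` of a hyperbolic punctured surface group, `r ≥ 1` (free of rank `2g + r − 1 ≥ 2`).

* `geom_ne_bot_of_isProSigmaCompletion_puncturedSurfaceGroup` — `Δ ≠ 1` (`δ¹_ℓ(Δ) = 2g + r − 1 ≥ 1`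
  gives a continuous surjection onto some `ℤ_ℓ^N`, `N ≥ 1`);
* `prop22_prop23_of_isProSigmaCompletion_puncturedSurfaceGroup_mlf` / `_nf` —
  **`E.GeomTFG ∧ E.GeomSlimElastic ∧ E.ArithSlimNotElastic`** for MLF / NF base data: Prop 2.2 by the
  tree's `geomTFG_of_isProSigmaCompletion_puncturedSurfaceGroup`, Prop 2.3 (i) by abc-iut-w5-d206's
  `slim_and_elastic_of_isProSigmaCompletion_puncturedSurfaceGroup` (p424779; rank route), Prop 2.3 (ii)
  by abc-iut-L4-d1's `MLFBase.arithSlimNotElastic'` / `NFBase.arithSlimNotElastic'` (slim-by-slim is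
  slim; `Δ ≠ 1` tfg closed normal of infinite index kills elasticity of `Π`).

PROOF-ONLY (no definitions, no named facts); classical; nothing here bears on [IUTchIII] Cor. 3.12.
-/

noncomputable section

namespace Literature.AnabelianGeometry.AbsoluteAnabelian.FundamentalExtension

open Literature.AnabelianGeometry.SemiGraphs.SemiGraphOfAnabelioids
open Literature.GroupTheory.CombinatorialGroupTheory

variable {E : FundamentalExtension.{0}} {Sigma : Set ℕ} {g r : ℕ}

/-- **`Δ ≠ 1` at the affine model**: a pro-`Σ` completion of `Γ_{g,r}` (`r ≥ 1`, `(g, r)` hyperbolic,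
`Σ` containing a prime `ℓ`) has `δ¹_ℓ = 2g + r − 1 ≥ 2`
(`freeProlRank_eq_card_of_isProSigmaCompletion_freeGroup` along `Γ_{g,r} ≅ F_{2g+r−1}`), so it surjects
continuously onto some `ℤ_ℓ^N`, `N ≥ 1`, and is nontrivial. [cite: MochizukiAbsTopI2012, Prop 2.3 (i) p.19] -/
theorem geom_ne_bot_of_isProSigmaCompletion_puncturedSurfaceGroup (E : FundamentalExtension.{0})
    (hS : ∃ ℓ ∈ Sigma, ℓ.Prime) (hr : 1 ≤ r) (h : PuncturedSurfaceGroup.IsHyperbolicType g r)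
    (ι : PuncturedSurfaceGroup g r →* E.geom) (hι : IsProSigmaCompletion Sigma ι) : E.geom ≠ ⊥ := by
  classical
  obtain ⟨ℓ, hℓS, hℓ⟩ := hS
  haveI : Fact ℓ.Prime := ⟨hℓ⟩
  haveI : CompactSpace E.geom := isCompact_iff_compactSpace.mp E.isClosed_geom.isCompact
  obtain ⟨r', rfl⟩ : ∃ r', r = r' + 1 := ⟨r - 1, by omega⟩
  obtain ⟨e⟩ := PuncturedSurfaceGroup.nonempty_mulEquiv_freeGroup g r'
  have hι' : IsProSigmaCompletion Sigma (ι.comp e.symm.toMonoidHom) :=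
    hι.of_comp_mulEquiv e.symm (fun _ => rfl)
  have hrank := freeProlRank_eq_card_of_isProSigmaCompletion_freeGroup hι' hℓS
  have hcard : 1 ≤ Fintype.card ((Fin g × Bool) ⊕ Fin r') := by
    have hh : 2 < 2 * g + (r' + 1) := h
    simp only [Fintype.card_sum, Fintype.card_prod, Fintype.card_fin, Fintype.card_bool]
    omega
  have h1 : ((1 : ℕ) : ℕ∞) ≤ freeProlRank E.geom ℓ := by
    rw [hrank]
    exact_mod_cast hcard
  obtain ⟨N, F, hN, hF⟩ := exists_surjective_of_le_freeProlRank ℓ Nat.one_pos h1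
  rw [← Subgroup.nontrivial_iff_ne_bot]
  haveI : Nonempty (Fin N) := ⟨⟨0, by omega⟩⟩
  haveI : Nontrivial (Multiplicative (Fin N → ℤ_[ℓ])) :=
    Multiplicative.ofAdd.injective.nontrivial
  exact hF.nontrivial

/-- **[AbsTopI] Prop 2.2 + Prop 2.3 (i) + Prop 2.3 (ii) at the affine model, MLF base.**  For an
extension `1 → Δ → Π → G → 1` with MLF base data `G ≅ G_k` whose `Δ` is presented as a pro-`Σ`
completion of a hyperbolic `Γ_{g,r}`, `r ≥ 1` (`Σ` containing a prime): `Δ` is topologically finitely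
generated, `Δ` is slim and elastic, and `Π` is slim but not elastic — the three typed predicates HOLD.
[cite: MochizukiAbsTopI2012, Prop 2.3 p.19] -/
theorem prop22_prop23_of_isProSigmaCompletion_puncturedSurfaceGroup_mlf (B : E.MLFBase)
    (hS : ∃ ℓ ∈ Sigma, ℓ.Prime) (hr : 1 ≤ r) (h : PuncturedSurfaceGroup.IsHyperbolicType g r)
    (ι : PuncturedSurfaceGroup g r →* E.geom) (hι : IsProSigmaCompletion Sigma ι) :
    E.GeomTFG ∧ E.GeomSlimElastic ∧ E.ArithSlimNotElastic := by
  haveI : CompactSpace E.geom := isCompact_iff_compactSpace.mp E.isClosed_geom.isCompact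
  have htfg : E.GeomTFG := E.geomTFG_of_isProSigmaCompletion_puncturedSurfaceGroup ι hι
  have hse : E.GeomSlimElastic :=
    slim_and_elastic_of_isProSigmaCompletion_puncturedSurfaceGroup hr h hι hS
  have hne := E.geom_ne_bot_of_isProSigmaCompletion_puncturedSurfaceGroup hS hr h ι hι
  exact ⟨htfg, hse, B.arithSlimNotElastic' hse.1 hne htfg⟩

/-- **[AbsTopI] Prop 2.2 + Prop 2.3 (i) + Prop 2.3 (ii) at the affine model, NF base** (same
statement for extensions with number-field base data `G ≅ G_F`).
[cite: MochizukiAbsTopI2012, Prop 2.3 p.19] -/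
theorem prop22_prop23_of_isProSigmaCompletion_puncturedSurfaceGroup_nf (B : E.NFBase)
    (hS : ∃ ℓ ∈ Sigma, ℓ.Prime) (hr : 1 ≤ r) (h : PuncturedSurfaceGroup.IsHyperbolicType g r)
    (ι : PuncturedSurfaceGroup g r →* E.geom) (hι : IsProSigmaCompletion Sigma ι) :
    E.GeomTFG ∧ E.GeomSlimElastic ∧ E.ArithSlimNotElastic := by
  haveI : CompactSpace E.geom := isCompact_iff_compactSpace.mp E.isClosed_geom.isCompact
  have htfg : E.GeomTFG := E.geomTFG_of_isProSigmaCompletion_puncturedSurfaceGroup ι hι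
  have hse : E.GeomSlimElastic :=
    slim_and_elastic_of_isProSigmaCompletion_puncturedSurfaceGroup hr h hι hS
  have hne := E.geom_ne_bot_of_isProSigmaCompletion_puncturedSurfaceGroup hS hr h ι hι
  exact ⟨htfg, hse, B.arithSlimNotElastic' hse.1 hne htfg⟩

end Literature.AnabelianGeometry.AbsoluteAnabelian.FundamentalExtension

end
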